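import Summits.RiemannHypothesis.RiemannHypothesis.Theorems.SuzukiSharpRadiusTwo
import Summits.RiemannHypothesis.RiemannHypothesis.Theorems.SuzukiSharpRadius

/-!
# SuzukiSharpRadius — rung 2, the VALUE: `ξ'/ξ(2) ≥ (291/98)·ξ'/ξ(1)`, hence every `c < (97/98)·c⋆` is a
linear clean radius (column DBR; RH-FREE)

RH-FREE throughout; nothing here bears on the truth of RH (a clean window certifies nothing about RH).

Fourth proof file of the cell rh-dbr's theory target T-LCR⋆.  The one-line minimum on `Re s = 2`
(`Theorems.SuzukiSharpRadiusTwo.xiLogDerivMinOnAxisAt_two`) makes every `c < (2/3)·ξ'/ξ(2)` a linear clean radius;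
here the VALUE `ξ'/ξ(2)` is bounded from below WITHOUT any prime sum (`Σ Λ(n)/n² = −ζ'/ζ(2)` is never evaluated) and
WITHOUT located zeros, by comparing the two Hadamard sums over the SAME pairs of zeros `{ρ, 1−ρ}`
(`IsHadamardSeq.re_logDeriv_riemannXi_eq_tsum` at `s = 2` and at `s = 1`):

* `pair_term_ineq` — for `0 < β < 1` and `γ² ≥ 196`, with `ρ = β + iγ`:
  `(2−β)/((2−β)²+γ²) + (1+β)/((1+β)²+γ²) ≥ (3 − 6/γ²)·[(1−β)/((1−β)²+γ²) + β/(β²+γ²)]`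
  (the `s = 2` pair term against the `s = 1` pair term; after the symmetric substitution `β = ½ + x`, `u = x²`
  the difference of the cross-multiplied sides is the explicit polynomial
  `27/2 G² + 42 G²u + 135/4 G − 36 G u − 12 G u² + 243/32 − 297/8 u + 57/2 u² − 6 u³ ≥ 0`, `G = γ²`; the
  constant `6` is sharp at `β = ½`, `γ → ∞`).
* `xiLogDerivRe_two_ge` — **`ξ'/ξ(2) ≥ (291/98)·ξ'/ξ(1)`** (`|γ| > 14` for every zero, kernel-checked `N(14) = 0`,
  so `3 − 6/γ² ≥ 3 − 3/98`); numerically `0.0685800 ≤ ξ'/ξ(2) = 0.0690658…`.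
* `linearCleanRadiusBelow_rung_two : LinearCleanRadiusBelow (97/98 · sharpCleanConst)` — since
  `c⋆ = sharpCleanConst = 2·ξ'/ξ(1)` (S1, `Theorems.SuzukiSharpRadiusXiAtOne`), the rung-2 radius
  `(2/3)·ξ'/ξ(2) ≥ (97/98)·c⋆`: **every `c < (97/98)·c⋆ = 0.0457207…` is a linear clean radius**, unconditionally
  (rung 1, `σ = 8`: `0.0427`; the sharp constant `c⋆ = 2 + γ − log 4π = 0.0461914…` is rung 3).
* `linearCleanRadiusBelow_0457 : LinearCleanRadiusBelow 0.0457` (with `0.04619 < c⋆`, `sharpCleanConst_bounds`).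

References: J. C. Lagarias, Acta Arith. 89 (1999), §3 (pairing of the Hadamard sum); [Su20] M. Suzuki, ASPM 84 (2020),
(1.9).  Cell memo TARGET-v7 §K.8 (rung 2 target "c < 0.0460 = 99.6 % of c⋆"; this file certifies 98.98 % with no
zero data beyond `N(14) = 0`; the remaining 0.6 % would need the located low zeros).
-/

noncomputable section

-- D-0017: `Summit.<S>.<S>.…` is the designed namespace of a single-problem summit.
set_option linter.dupNamespace false

open Complex

namespace Summit.RiemannHypothesis.RiemannHypothesis.Theorems.SuzukiSharpRadius

open Literature.NumberTheory.LFunctions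
open Summit.RiemannHypothesis.RiemannHypothesis.Theorems.SuzukiCleanRadius

/-! ## §1 The pair inequality -/

/-- RH-FREE (the polynomial certificate of the pair inequality): for `196 ≤ G` and `0 ≤ u ≤ 1/4`,
`0 ≤ 27/2 G² + 42 G²u + 135/4 G − 36 G u − 12 G u² + 243/32 − 297/8 u + 57/2 u² − 6 u³`. -/
theorem pair_poly_nonneg {G u : ℝ} (hG : 196 ≤ G) (hu0 : 0 ≤ u) (hu4 : u ≤ 1 / 4) :
    0 ≤ 27 / 2 * G ^ 2 + 42 * G ^ 2 * u + 135 / 4 * G - 36 * G * u - 12 * G * u ^ 2 + 243 / 32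
        - 297 / 8 * u + 57 / 2 * u ^ 2 - 6 * u ^ 3 := by
  have hG0 : 0 ≤ G := by linarith
  have f1 : G * u ≤ G * (1 / 4) := mul_le_mul_of_nonneg_left hu4 hG0
  have hu2 : u ^ 2 ≤ 1 / 16 := by nlinarith
  have f2 : G * u ^ 2 ≤ G * (1 / 16) := mul_le_mul_of_nonneg_left hu2 hG0
  have f3 : u ^ 3 ≤ 1 / 64 := by nlinarith
  have f4 : 0 ≤ G ^ 2 * u := by positivity
  have f5 : 0 ≤ u ^ 2 := sq_nonneg u
  have f6 : 196 * G ≤ G ^ 2 := by rw [sq]; exact mul_le_mul_of_nonneg_right hG hG0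
  linarith

/-- RH-FREE (the `s = 1` pair term in the symmetric variable `(β − ½)²`):
`(1−β)/((1−β)²+G) + β/(β²+G) = (¼ + G − (β−½)²)/((¼ − (β−½)²)² + 2G(¼ + (β−½)²) + G²)` (`G > 0`). -/
theorem known_pair_eq {β G : ℝ} (hG : 0 < G) :
    (1 - β) / ((1 - β) ^ 2 + G) + β / (β ^ 2 + G) =
      (1 / 4 + G - (β - 1 / 2) ^ 2) /
        ((1 / 4 - (β - 1 / 2) ^ 2) ^ 2 + 2 * G * (1 / 4 + (β - 1 / 2) ^ 2) + G ^ 2) := by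
  have h1 : (1 - β) ^ 2 + G ≠ 0 := by positivity
  have h2 : β ^ 2 + G ≠ 0 := by positivity
  have hd : ((1 - β) ^ 2 + G) * (β ^ 2 + G) =
      (1 / 4 - (β - 1 / 2) ^ 2) ^ 2 + 2 * G * (1 / 4 + (β - 1 / 2) ^ 2) + G ^ 2 := by ring
  rw [div_add_div _ _ h1 h2, hd]
  congr 1
  ring

/-- RH-FREE (the `s = 2` pair term in the symmetric variable):
`(2−β)/((2−β)²+G) + (1+β)/((1+β)²+G) = 3(9/4 + G − (β−½)²)/((9/4 − (β−½)²)² + 2G(9/4 + (β−½)²) + G²)` (`G > 0`). -/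
theorem ours_pair_eq {β G : ℝ} (hG : 0 < G) :
    (2 - β) / ((2 - β) ^ 2 + G) + (1 + β) / ((1 + β) ^ 2 + G) =
      3 * (9 / 4 + G - (β - 1 / 2) ^ 2) /
        ((9 / 4 - (β - 1 / 2) ^ 2) ^ 2 + 2 * G * (9 / 4 + (β - 1 / 2) ^ 2) + G ^ 2) := by
  have h1 : (2 - β) ^ 2 + G ≠ 0 := by positivity
  have h2 : (1 + β) ^ 2 + G ≠ 0 := by positivity
  have hd : ((2 - β) ^ 2 + G) * ((1 + β) ^ 2 + G) =
      (9 / 4 - (β - 1 / 2) ^ 2) ^ 2 + 2 * G * (9 / 4 + (β - 1 / 2) ^ 2) + G ^ 2 := by ring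
  rw [div_add_div _ _ h1 h2, hd]
  congr 1
  ring

/-- **RH-FREE, the pair inequality**: for `0 < β < 1` and `196 ≤ G` (`G = γ²`),
`(3 − 6/G)·[(1−β)/((1−β)²+G) + β/(β²+G)] ≤ (2−β)/((2−β)²+G) + (1+β)/((1+β)²+G)` — the `s = 1` pair term of the
Hadamard sum against the `s = 2` pair term of the same pair `{ρ, 1−ρ}`.  Sharp at `β = ½`. -/
theorem pair_term_ineq {β G : ℝ} (hβ0 : 0 < β) (hβ1 : β < 1) (hG : 196 ≤ G) :
    (3 - 6 / G) * ((1 - β) / ((1 - β) ^ 2 + G) + β / (β ^ 2 + G)) ≤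
      (2 - β) / ((2 - β) ^ 2 + G) + (1 + β) / ((1 + β) ^ 2 + G) := by
  have hG0 : 0 < G := by linarith
  have hu4 : (β - 1 / 2) ^ 2 ≤ 1 / 4 := by nlinarith [mul_pos hβ0 (sub_pos.2 hβ1)]
  have e36 : (3 - 6 / G) = (3 * G - 6) / G := by
    field_simp
  rw [known_pair_eq hG0, ours_pair_eq hG0, e36, div_mul_div_comm]
  set u : ℝ := (β - 1 / 2) ^ 2 with hu
  have hu0 : 0 ≤ u := sq_nonneg _
  have hP1 : 0 < G * ((1 / 4 - u) ^ 2 + 2 * G * (1 / 4 + u) + G ^ 2) := by positivity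
  have hP3 : 0 < (9 / 4 - u) ^ 2 + 2 * G * (9 / 4 + u) + G ^ 2 := by positivity
  rw [div_le_div_iff₀ hP1 hP3]
  have key : 3 * (9 / 4 + G - u) * (G * ((1 / 4 - u) ^ 2 + 2 * G * (1 / 4 + u) + G ^ 2)) -
      (3 * G - 6) * (1 / 4 + G - u) * ((9 / 4 - u) ^ 2 + 2 * G * (9 / 4 + u) + G ^ 2) =
      27 / 2 * G ^ 2 + 42 * G ^ 2 * u + 135 / 4 * G - 36 * G * u - 12 * G * u ^ 2 + 243 / 32
        - 297 / 8 * u + 57 / 2 * u ^ 2 - 6 * u ^ 3 := by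
    ring
  have hnn := pair_poly_nonneg hG hu0 hu4
  rw [← key] at hnn
  linarith

/-! ## §2 The two Hadamard sums over the same pairs `{ρ, 1 − ρ}` -/

/-- RH-FREE.  `Re 1/(a − ρ) = (a − β)/((a − β)² + γ²)` for real `a` and `ρ = β + iγ`. -/
theorem re_inv_ofReal_sub (a : ℝ) (ρ : ℂ) :
    (1 / ((a : ℂ) - ρ)).re = (a - ρ.re) / ((a - ρ.re) ^ 2 + ρ.im ^ 2) := by
  rw [IsHadamardSeq.re_inv_sub_eq, Complex.sq_norm, Complex.normSq_apply]
  simp only [sub_re, ofReal_re, sub_im, ofReal_im, zero_sub, mul_neg, neg_mul, neg_neg]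
  ring

/-- RH-FREE.  The same for the partner `1 − ρ`: `Re 1/(a − (1−ρ)) = (a − 1 + β)/((a − 1 + β)² + γ²)`. -/
theorem re_inv_ofReal_sub_one_sub (a : ℝ) (ρ : ℂ) :
    (1 / ((a : ℂ) - (1 - ρ))).re = (a - 1 + ρ.re) / ((a - 1 + ρ.re) ^ 2 + ρ.im ^ 2) := by
  rw [re_inv_ofReal_sub]
  simp only [sub_re, one_re, sub_im, one_im, zero_sub, even_two, Even.neg_pow]
  ring

/-- RH-FREE.  The real pair terms of the Hadamard sum of `ξ'/ξ` are summable where `ξ ≠ 0`. -/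
theorem summable_re_pairs {b : ℕ → ℂ} (hb : IsHadamardSeq 0 b) {s : ℂ} (hs : riemannXi s ≠ 0) :
    Summable fun n ↦ if b n = 0 then (0 : ℝ) else
      (1 / (s - IsHadamardSeq.xiZero b n)).re + (1 / (s - (1 - IsHadamardSeq.xiZero b n))).re := by
  have := (hb.summable_pairs hs).mapL Complex.reCLM
  refine this.congr fun n ↦ ?_
  simp only [Complex.reCLM_apply]
  split_ifs <;> simp

/-- **RH-FREE · the value of rung 2: `ξ'/ξ(2) ≥ (291/98)·ξ'/ξ(1)`** (`= 2.9693…·0.0230957… = 0.0685800…`; true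
value `0.0690658…`).  Both sides are Hadamard sums over the same pairs `{ρ, 1−ρ}` (`exists_isHadamardSeq`,
`IsHadamardSeq.re_logDeriv_riemannXi_eq_tsum` at `s = 2`, `s = 1`), compared termwise by `pair_term_ineq` with
`γ² > 196` (`Lagarias1999.sq_im_gt`, from the kernel-checked `N(14) = 0`). No prime sum, no located zero. -/
theorem xiLogDerivRe_two_ge : 291 / 98 * xiLogDerivRe 1 0 ≤ xiLogDerivRe 2 0 := by
  rw [xiLogDerivRe_eq_logDeriv, xiLogDerivRe_eq_logDeriv]
  have e1 : ((1 : ℝ) : ℂ) + ((0 : ℝ) : ℂ) * I = ((1 : ℝ) : ℂ) := by simp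
  have e2 : ((2 : ℝ) : ℂ) + ((0 : ℝ) : ℂ) * I = ((2 : ℝ) : ℂ) := by simp
  rw [e1, e2]
  have hξ1 : riemannXi ((1 : ℝ) : ℂ) ≠ 0 := by
    rw [Complex.ofReal_one, riemannXi_one]; norm_num
  have hξ2 : riemannXi ((2 : ℝ) : ℂ) ≠ 0 := riemannXi_ne_zero_of_one_le_re (by simp)
  obtain ⟨b, hb⟩ := exists_isHadamardSeq 0
  have H1 : HasSum (fun n ↦ if b n = 0 then (0 : ℝ) else
      (1 / (((1 : ℝ) : ℂ) - IsHadamardSeq.xiZero b n)).re +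
        (1 / (((1 : ℝ) : ℂ) - (1 - IsHadamardSeq.xiZero b n))).re)
      (logDeriv riemannXi ((1 : ℝ) : ℂ)).re := by
    rw [hb.re_logDeriv_riemannXi_eq_tsum hξ1]
    exact (summable_re_pairs hb hξ1).hasSum
  have H2 : HasSum (fun n ↦ if b n = 0 then (0 : ℝ) else
      (1 / (((2 : ℝ) : ℂ) - IsHadamardSeq.xiZero b n)).re +
        (1 / (((2 : ℝ) : ℂ) - (1 - IsHadamardSeq.xiZero b n))).re)
      (logDeriv riemannXi ((2 : ℝ) : ℂ)).re := by
    rw [hb.re_logDeriv_riemannXi_eq_tsum hξ2]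
    exact (summable_re_pairs hb hξ2).hasSum
  refine hasSum_le (fun n ↦ ?_) (H1.mul_left (291 / 98)) H2
  -- termwise
  split_ifs with hn
  · simp
  obtain ⟨hζ, hβ0, hβ1⟩ := hb.riemannZeta_xiZero hn
  set ρ : ℂ := IsHadamardSeq.xiZero b n with hρ
  have hmem : ρ ∈ RHWave0.riemannZetaNontrivialZeros :=
    ZetaZeros.riemannZetaNontrivialZeros.mem_of_re_pos hζ hβ0
  have hγ : 196 < ρ.im ^ 2 := Lagarias1999.sq_im_gt ⟨ρ, hmem⟩
  rw [re_inv_ofReal_sub, re_inv_ofReal_sub_one_sub, re_inv_ofReal_sub, re_inv_ofReal_sub_one_sub]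
  have ek : (1 - 1 + ρ.re) / ((1 - 1 + ρ.re) ^ 2 + ρ.im ^ 2) = ρ.re / (ρ.re ^ 2 + ρ.im ^ 2) := by ring_nf
  have eo : (2 - 1 + ρ.re) / ((2 - 1 + ρ.re) ^ 2 + ρ.im ^ 2) = (1 + ρ.re) / ((1 + ρ.re) ^ 2 + ρ.im ^ 2) := by
    ring_nf
  rw [ek, eo]
  have h := pair_term_ineq (G := ρ.im ^ 2) hβ0 hβ1 hγ.le
  have hknown : 0 ≤ (1 - ρ.re) / ((1 - ρ.re) ^ 2 + ρ.im ^ 2) + ρ.re / (ρ.re ^ 2 + ρ.im ^ 2) := by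
    have : 0 < 1 - ρ.re := by linarith
    positivity
  have h6 : (291 : ℝ) / 98 ≤ 3 - 6 / ρ.im ^ 2 := by
    have hpos : (0 : ℝ) < ρ.im ^ 2 := by linarith
    have : 6 / ρ.im ^ 2 ≤ 6 / 196 := div_le_div_of_nonneg_left (by norm_num) (by norm_num) hγ.le
    linarith
  calc 291 / 98 * ((1 - ρ.re) / ((1 - ρ.re) ^ 2 + ρ.im ^ 2) + ρ.re / (ρ.re ^ 2 + ρ.im ^ 2))
      ≤ (3 - 6 / ρ.im ^ 2) * ((1 - ρ.re) / ((1 - ρ.re) ^ 2 + ρ.im ^ 2) + ρ.re / (ρ.re ^ 2 + ρ.im ^ 2)) :=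
        mul_le_mul_of_nonneg_right h6 hknown
    _ ≤ (2 - ρ.re) / ((2 - ρ.re) ^ 2 + ρ.im ^ 2) + (1 + ρ.re) / ((1 + ρ.re) ^ 2 + ρ.im ^ 2) := h

/-! ## §3 The radius of rung 2: `(2/3)·ξ'/ξ(2)`, i.e. `97/98` of the sharp constant -/

/-- **RH-FREE corollary (the linear clean radius of rung 2, symbolic form)**: every `c < ξ'/ξ(2)/(3/2) = (2/3)·ξ'/ξ(2)`
(`= 0.04604…`, 99.7 % of `c⋆ = 2 + γ − log 4π`) is a linear clean radius of Suzuki's single operator: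
`∃ θ₁ ∀ θ ≥ θ₁, CleanUpTo θ (c·θ)` (eng-5's window mechanism `linear_clean_radius_of_line_min` on the line `σ = 2`,
`b = 3/2`, fed with `xiLogDerivMinOnAxisAt_two`).  A clean radius certifies nothing about RH. -/
theorem linearCleanRadiusBelow_two : LinearCleanRadiusBelow (xiLogDerivRe 2 0 / (3 / 2)) := by
  have h := linear_clean_radius_of_line_min (σ := 2) (by norm_num) xiLogDerivMinOnAxisAt_two
  intro c hc
  have e : (2 : ℝ) - 1 / 2 = 3 / 2 := by norm_num
  exact h c (by rw [e]; exact hc)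

/-- **RH-FREE · RUNG 2 reaches `97/98` of the sharp constant**: every `c < (97/98)·c⋆`
(`c⋆ = sharpCleanConst = 2 + γ − log 4π = 2ξ'/ξ(1)`; `(97/98)c⋆ = 0.0457207…`) is a linear clean radius of Suzuki's
single operator — `∃ θ₁ ∀ θ ≥ θ₁, CleanUpTo θ (c·θ)`.  (`(2/3)·ξ'/ξ(2) ≥ (2/3)(291/98)·ξ'/ξ(1) = (97/98)·2ξ'/ξ(1)`.)
A clean radius certifies nothing about RH. -/
theorem linearCleanRadiusBelow_rung_two : LinearCleanRadiusBelow (97 / 98 * sharpCleanConst) := by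
  intro c hc
  have h2 := xiLogDerivRe_two_ge
  rw [sharpCleanConst_eq_two_mul] at hc
  exact linearCleanRadiusBelow_two c (by linarith)

/-- **RH-FREE · numeric form**: every `c < 0.0457` is a linear clean radius of Suzuki's single operator
(`0.0457 < (97/98)·0.04619 < (97/98)·c⋆`, `sharpCleanConst_bounds`).  Rung 1 (`σ = 8`,
`Theorems.SuzukiSharpRadiusEight`) gives `0.0427`; the sharp constant is `c⋆ = 0.0461914…`. -/
theorem linearCleanRadiusBelow_0457 : LinearCleanRadiusBelow 0.0457 := by
  intro c hc
  have hb := sharpCleanConst_bounds.1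
  exact linearCleanRadiusBelow_rung_two c (by linarith)

end Summit.RiemannHypothesis.RiemannHypothesis.Theorems.SuzukiSharpRadius

end
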